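import Summits.ResolutionOfSingularities.ResolutionOfSingularities.Theorems.EquisingularLiftEquisingularLiftNatP1VBReductionSections
import Summits.ResolutionOfSingularities.ResolutionOfSingularities.Theorems.EquisingularLiftEquisingularLiftNatP1VBTwoChartCech
import Literature.AlgebraicGeometry.Morphisms.Devissage
import Literature.AlgebraicGeometry.Morphisms.DevissageHeart
import Literature.AlgebraicGeometry.Morphisms.CohOfVectorBundle
import Literature.AlgebraicGeometry.Morphisms.CechModuleUnit
import Mathlib.RingTheory.Nakayama
import HarnessLib

/-!
# [OURS · L1 W4.5(b) · T-P1VB part 2b] The H⁰-LIFTING core: `Ȟ¹(𝒰_B; g^*F) = 0 ⇒ Γ(X, F) → Γ(X ×_A B, g^*F)` is onto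
# (proper `X/A`, `A` Noetherian local, two affine charts — e.g. `ℙ¹_O → ℙ¹_k`)

Cell res-hironaka, LADDER-RESOLUTION rung L (D-0089), slot W4.5(b), crux `Theses.EquisingularLift.EquisingularLiftNat`
(stmt-ResolutionOfSingularities-20038) / child `EquisingularLiftNatThree` (stmt-ResolutionOfSingularities-20148); object **T-P1VB**
(res-L1-w45b-lead-2 BOOK 2026-08-27T09:28:20Z, rung v8 DIR₀ of LEAD-MEMO-5: «(a) ⇒ ∃ sub-line-bundle L ⊂ 𝒩 with L|_{ℙ¹_k} = L₀ …
a section σ₀ of 𝒩_k(−ℓ) lifts to σ ∈ H⁰(𝒩(−ℓ)) when H¹(𝒩_k(−ℓ)) = 0»), `--supports stmt-ResolutionOfSingularities-20148 --as helper`.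
NOT a statement of any manuscript; OURS. AI-written; AI review is weaker than expert review.

THEOREM (`exists_unitSection_eq`). Let `A` be a Noetherian LOCAL ring, `φ : A → B` a surjection onto a non-zero ring (e.g. the
residue field; `ker φ ⊆ 𝔪_A`), `f : X → Spec A` PROPER, `g : Y = X ×_A B → X` the base change (`IsPullback g t f (Spec φ)`, a closed
immersion), `X = U₀ ∪ U₁` with `U₀, U₁, U₀ ∩ U₁` AFFINE (the two standard charts of `ℙ¹_A`), `F` a vector bundle on `X`
(`Motives.IsVectorBundle`), and suppose the Čech group of the restriction vanishes: `Ȟ¹((g⁻¹U₀, g⁻¹U₁); g^*F) = 0`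
(`Subsingleton (CechMH1 t (g^*F) (g⁻¹U_·))`, tree `Morphisms/CechModule`; part 2a gives the explicit form). Then EVERY global
section of `g^*F` is the pull-back `η(s)` of a global section `s` of `F`. No completeness of `A` is used.

PROOF (Nakayama on the two-chart Čech complex; the degree-`0` case of cohomology and base change done by hand).
`δ : Γ(U₀,F) × Γ(U₁,F) → Γ(U₀∩U₁,F)`, `(b₀,b₁) ↦ b₁| − b₀|` (part 2a `cechDelta`); `I = ker φ`.
(1) `range_cechDelta_sup_smul_top`: `Γ(U₀∩U₁,F) = im δ + I·Γ(U₀∩U₁,F)` — reduce `y`, write the reduction as a difference downstairs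
(`Ȟ¹ = 0`, part 2a `exists_cechDelta_eq_of_subsingleton`), lift the pieces along the surjections `Γ(U_i,F) → Γ(g⁻¹U_i, g^*F)` and
note the error dies downstairs, so lies in `I·Γ(U₀∩U₁,F)` (part 1 `unitSection_eq_zero_iff_mem_smul_top`, `U₀∩U₁` affine).
(2) `range_cechDelta_eq_top`: `Q = Γ(U₀∩U₁,F)/im δ` is a finite `A`-module — `Ȟ¹(𝒰;F)` is finite by the tree's dévissage
(`Morphisms/Devissage.devissage` + `DevissageHeart.heart_holds` + `CohOfVectorBundle.coh_of_isVectorBundle`; `f` proper, `A`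
Noetherian) and `Ȟ¹ ↠ Q` (part 2a) — and `Q = I Q` by (1), so `Q = 0` (Mathlib `Submodule.eq_bot_of_le_smul_of_le_jacobson_bot`,
`I ⊆ 𝔪_A = Jac A`): `δ` is onto.
(3) `exists_unitSection_eq`: lift `s₀|_{g⁻¹U_i} = η(a_i)`; `δ(a)` dies downstairs so `δ(a) ∈ I·Γ(U₀∩U₁,F) = δ(I·Č⁰)` (δ onto),
say `δ(a) = δ(b)` with `b ∈ I·Č⁰`, whence `η(b_i) = 0`; `a − b` is a Čech `0`-cocycle, glues (tree `cechMH0EquivSections`) to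
`s ∈ Γ(X, F)` with `η(s)|_{g⁻¹U_i} = η(a_i − b_i) = s₀|_{g⁻¹U_i}`, so `η(s) = s₀` (locality on the cover `g⁻¹U_i` of `Y`).

References (index only): Hartshorne III.12.11 / Mumford, *Abelian Varieties* §5 (cohomology and base change, degree 0);
The Stacks Project, Tag 01ED; Mathlib `RingTheory/Nakayama`.
-/

noncomputable section

open CategoryTheory AlgebraicGeometry TopologicalSpace Opposite
open Literature.AlgebraicGeometry.Morphisms Literature.AlgebraicGeometry.Modules Literature.AlgebraicGeometry

universe u

set_option linter.dupNamespace false -- mandated namespace `Summit.<Summit>.<Problem>` of this single-conjunct summit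

namespace Summit.ResolutionOfSingularities.ResolutionOfSingularities.Cruxes.EquisingularLiftNat.P1VB

variable {A : Type u} [CommRing A] {X : Scheme.{u}} (f : X ⟶ Spec (.of A)) (U : Fin 2 → X.Opens)

/-! ### Setting and two small compatibilities of `η` -/

section Core

variable {B : Type u} [CommRing B] (φ : A →+* B) {Y : Scheme.{u}} {g : Y ⟶ X} {t : Y ⟶ Spec (.of B)}
  (F : X.Modules)

/-- Pull-back of sections is compatible with subtraction. [folklore] -/
theorem unitSection_sub (V : X.Opens) (m m' : MSections f F V) :
    unitSection g F V (m - m') = unitSection g F V m - unitSection g F V m' :=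
  map_sub ((pullbackUnit g F).app V).hom m m'

/-- Pull-back of sections commutes with the restriction maps of the tree's `MSections`. [folklore] -/
theorem unitSection_res {V W : X.Opens} (h : W ≤ V) (m : MSections f F V) :
    unitSection g F W (MSections.res f F h m) =
      MSections.res t ((Scheme.Modules.pullback g).obj F) (Scheme.Hom.preimage_mono g h)
        (unitSection g F V m) :=
  unitSection_map g F (homOfLE h) m

/-- **Step 1 — `Γ(U₀ ∩ U₁, F) = im δ + (ker φ)·Γ(U₀ ∩ U₁, F)` from `Ȟ¹ = 0` downstairs.** For the base change `g`
of a surjection `φ : A → B` along `f`, two affine opens `U₀, U₁` of `X` with affine intersection, `F` affine-localizing,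
and `Ȟ¹((g⁻¹U₀, g⁻¹U₁); g^*F) = 0`: every `y ∈ Γ(U₀ ∩ U₁, F)` is `b₁| − b₀|` modulo `(ker φ) Γ(U₀ ∩ U₁, F)`
(reduce `y`, write the reduction as a difference downstairs, lift the two pieces along the surjections
`Γ(U_i, F) → Γ(g⁻¹U_i, g^*F)`, and the error dies downstairs, so lies in `(ker φ)Γ(U₀ ∩ U₁, F)` — part 1). [folklore] -/
theorem range_cechDelta_sup_smul_top (hφ : Function.Surjective φ)
    (H : IsPullback g t f (Spec.map (CommRingCat.ofHom φ))) (hF : IsAffineLocalizing F)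
    (hU : ∀ i, IsAffineOpen (U i)) (hU01 : IsAffineOpen (U 0 ⊓ U 1))
    (h1 : Subsingleton (CechMH1 t ((Scheme.Modules.pullback g).obj F) (fun i => g ⁻¹ᵁ U i))) :
    LinearMap.range (cechDelta f F U) ⊔ RingHom.ker φ • ⊤ = (⊤ : Submodule A (MSections f F (U 0 ⊓ U 1))) := by
  haveI := h1
  refine eq_top_iff.mpr fun y _ => ?_
  -- reduce `y` and write the reduction as a difference downstairs
  obtain ⟨c, hc⟩ := exists_cechDelta_eq_of_subsingleton t ((Scheme.Modules.pullback g).obj F)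
    (fun i => g ⁻¹ᵁ U i) (unitSection g F (U 0 ⊓ U 1) y)
  -- lift the two pieces
  choose b hb using fun i => unitSection_surjective_of_isPullback φ f hφ H F hF (hU i) (c i)
  refine Submodule.mem_sup.mpr ⟨cechDelta f F U b, ⟨b, rfl⟩, y - cechDelta f F U b, ?_, add_sub_cancel _ _⟩
  -- the error dies downstairs
  rw [← unitSection_eq_zero_iff_mem_smul_top φ f hφ H F hF hU01]
  rw [unitSection_sub, cechDelta_apply, unitSection_sub, unitSection_res f (t := t), unitSection_res f (t := t), hb, hb,
    sub_eq_zero]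
  exact hc.symm

/-- `ker φ ≤ 𝔪_A` lies in the Jacobson radical (`A` local, `B ≠ 0`). [folklore] -/
theorem ker_le_jacobson_bot [IsLocalRing A] [Nontrivial B] : RingHom.ker φ ≤ (⊥ : Ideal A).jacobson := by
  rw [IsLocalRing.jacobson_eq_maximalIdeal ⊥ bot_ne_top]
  exact IsLocalRing.le_maximalIdeal (RingHom.ker_ne_top φ)

variable [IsNoetherianRing A] [IsLocalRing A] [Nontrivial B] [IsProper f]

/-- **Step 2 — `δ` is onto (Nakayama).** Under the hypotheses of step 1 with `A` Noetherian local, `B ≠ 0`,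
`f : X → Spec A` proper, `U₀ ∪ U₁ = X` and `F` a vector bundle: `Γ(U₀ ∩ U₁, F)/im δ` is a finite `A`-module
(tree `Morphisms/Devissage`: `Ȟ¹(𝒰; F)` is finite; part 2a) equal to `(ker φ)` times itself, hence zero. [folklore] -/
theorem range_cechDelta_eq_top (hφ : Function.Surjective φ)
    (H : IsPullback g t f (Spec.map (CommRingCat.ofHom φ))) (hF : Motives.IsVectorBundle F)
    (hU : ∀ i, IsAffineOpen (U i)) (hU01 : IsAffineOpen (U 0 ⊓ U 1)) (hcov : ⨆ i, U i = ⊤)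
    (h1 : Subsingleton (CechMH1 t ((Scheme.Modules.pullback g).obj F) (fun i => g ⁻¹ᵁ U i))) :
    LinearMap.range (cechDelta f F U) = ⊤ := by
  -- finiteness of `Ȟ¹(𝒰; F)` by dévissage, hence of the quotient `Q = Γ(U₀ ∩ U₁, F)/im δ`
  haveI : IsLocallyNoetherian X := LocallyOfFiniteType.isLocallyNoetherian f
  haveI : CompactSpace X := QuasiCompact.compactSpace_of_compactSpace f
  have hK : InK f U F := devissage hU (heart_holds f hU hcov) F (coh_of_isVectorBundle hF)
  haveI := hK.finite_H1
  haveI := moduleFinite_quotient_range_cechDelta f F U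
  set N := LinearMap.range (cechDelta f F U) with hN
  -- `Q = (ker φ) Q`
  have hle : (⊤ : Submodule A (MSections f F (U 0 ⊓ U 1) ⧸ N)) ≤ RingHom.ker φ • ⊤ := by
    rintro q -
    obtain ⟨y, rfl⟩ := Submodule.Quotient.mk_surjective N q
    have hy : y ∈ N ⊔ RingHom.ker φ • ⊤ := by
      rw [hN, range_cechDelta_sup_smul_top f U φ F hφ H (coh_of_isVectorBundle hF).loc hU hU01 h1]
      trivial
    obtain ⟨n, hn, z, hz, rfl⟩ := Submodule.mem_sup.mp hy
    rw [Submodule.Quotient.mk_add, (Submodule.Quotient.mk_eq_zero N).mpr hn, zero_add]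
    have hmap : (RingHom.ker φ • (⊤ : Submodule A (MSections f F (U 0 ⊓ U 1)))).map N.mkQ =
        RingHom.ker φ • ⊤ := by
      rw [Submodule.map_smul'', Submodule.map_top, Submodule.range_mkQ]
    rw [← hmap]
    exact ⟨z, hz, rfl⟩
  -- Nakayama
  have hbot := Submodule.eq_bot_of_le_smul_of_le_jacobson_bot (RingHom.ker φ)
    (⊤ : Submodule A (MSections f F (U 0 ⊓ U 1) ⧸ N)) Module.Finite.fg_top hle (ker_le_jacobson_bot φ)
  refine eq_top_iff.mpr fun y _ => ?_
  rw [← Submodule.Quotient.mk_eq_zero N, ← Submodule.mem_bot A, ← hbot]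
  trivial

/-- **T-P1VB core — sections lift when `Ȟ¹` of the reduction vanishes.** Let `A` be Noetherian local, `φ : A → B`
a surjection onto a non-zero ring (e.g. the residue field), `f : X → Spec A` proper, `g : Y = X ×_A B → X` the base
change (`IsPullback g t f (Spec φ)`), `X = U₀ ∪ U₁` with `U₀, U₁, U₀ ∩ U₁` affine, and `F` a vector bundle on `X`
with `Ȟ¹((g⁻¹U₀, g⁻¹U₁); g^*F) = 0`. Then **every global section of `g^*F` is the pull-back `η(s)` of a global
section `s` of `F`**: `Γ(X, F) → Γ(Y, g^*F)` is onto. (For `X = ℙ¹_A`: `H¹(ℙ¹_k, F_k) = 0 ⇒ H⁰(ℙ¹_A, F) ↠ H⁰(ℙ¹_k, F_k)`,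
the degree-`0` case of cohomology and base change, here by Nakayama on the two-chart Čech complex.) [folklore] -/
theorem exists_unitSection_eq (hφ : Function.Surjective φ)
    (H : IsPullback g t f (Spec.map (CommRingCat.ofHom φ))) (hF : Motives.IsVectorBundle F)
    (hU : ∀ i, IsAffineOpen (U i)) (hU01 : IsAffineOpen (U 0 ⊓ U 1)) (hcov : ⨆ i, U i = ⊤)
    (h1 : Subsingleton (CechMH1 t ((Scheme.Modules.pullback g).obj F) (fun i => g ⁻¹ᵁ U i)))
    (s₀ : Γ((Scheme.Modules.pullback g).obj F, g ⁻¹ᵁ ⊤)) :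
    ∃ s : Γ(F, ⊤), unitSection g F ⊤ s = s₀ := by
  have hloc : IsAffineLocalizing F := (coh_of_isVectorBundle hF).loc
  -- lift `s₀` on the two charts
  choose a₀ ha₀ using fun i => unitSection_surjective_of_isPullback φ f hφ H F hloc (hU i)
    (MSections.res t ((Scheme.Modules.pullback g).obj F) (Scheme.Hom.preimage_mono g le_top) (s₀ : MSections t ((Scheme.Modules.pullback g).obj F) (g ⁻¹ᵁ ⊤)))
  let a : CechMC0 f F U := fun i => a₀ i
  have ha : ∀ i, unitSection g F (U i) (a i) =
      MSections.res t ((Scheme.Modules.pullback g).obj F) (Scheme.Hom.preimage_mono g le_top) (s₀ : MSections t ((Scheme.Modules.pullback g).obj F) (g ⁻¹ᵁ ⊤)) := ha₀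
  -- the difference `δ a` dies downstairs, hence lies in `(ker φ) Γ(U₀ ∩ U₁, F) = δ((ker φ) Č⁰)`
  have hδa : cechDelta f F U a ∈ RingHom.ker φ • (⊤ : Submodule A (MSections f F (U 0 ⊓ U 1))) := by
    rw [← unitSection_eq_zero_iff_mem_smul_top φ f hφ H F hloc hU01, cechDelta_apply, unitSection_sub,
      unitSection_res f (t := t), unitSection_res f (t := t), ha, ha, MSections.res_res, MSections.res_res, sub_self]
  have hsmul : RingHom.ker φ • (⊤ : Submodule A (MSections f F (U 0 ⊓ U 1))) =
      (RingHom.ker φ • (⊤ : Submodule A (CechMC0 f F U))).map (cechDelta f F U) := by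
    rw [Submodule.map_smul'', Submodule.map_top, range_cechDelta_eq_top f U φ F hφ H hF hU hU01 hcov h1]
  rw [hsmul] at hδa
  obtain ⟨b, hb, hδb⟩ := hδa
  -- the pieces of `b` die downstairs
  have hb0 : ∀ i, unitSection g F (U i) (b i) = 0 := fun i => by
    rw [unitSection_eq_zero_iff_mem_smul_top φ f hφ H F hloc (hU i)]
    have h2 : (b i : MSections f F (U i)) ∈
        (RingHom.ker φ • (⊤ : Submodule A (CechMC0 f F U))).map (LinearMap.proj i) := ⟨b, hb, rfl⟩
    rw [Submodule.map_smul'', Submodule.map_top] at h2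
    exact Submodule.smul_mono le_rfl le_top h2
  -- `a - b` is a Čech `0`-cocycle: glue it
  have hab : a - b ∈ cechMH0 f F U := by
    have h01 : MSections.res f F (inf_le_right : U 0 ⊓ U 1 ≤ U 1) ((a - b) 1) =
        MSections.res f F (inf_le_left : U 0 ⊓ U 1 ≤ U 0) ((a - b) 0) := by
      rw [← sub_eq_zero, ← cechDelta_apply, map_sub, hδb, sub_self]
    rw [mem_cechMH0_iff]
    intro i j
    revert i j
    refine Fin.forall_fin_two.mpr ⟨Fin.forall_fin_two.mpr ⟨rfl, h01⟩, Fin.forall_fin_two.mpr ⟨?_, rfl⟩⟩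
    have h10 := congrArg (MSections.res f F (le_of_eq (inf_comm (a := U 1) (b := U 0)))) h01
    rw [MSections.res_res, MSections.res_res] at h10
    exact h10.symm
  refine ⟨(cechMH0EquivSections f U F hcov).symm ⟨a - b, hab⟩, ?_⟩
  have hres : ∀ i, MSections.res f F (le_top : U i ≤ ⊤)
      ((cechMH0EquivSections f U F hcov).symm ⟨a - b, hab⟩) = a i - b i := fun i =>
    congrFun (congrArg Subtype.val ((cechMH0EquivSections f U F hcov).apply_symm_apply ⟨a - b, hab⟩)) i
  -- compare on the cover `g⁻¹U_i` of `Y`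
  refine MSections.eq_of_res_eq t ((Scheme.Modules.pullback g).obj F) (fun i => g ⁻¹ᵁ U i) (fun i => Scheme.Hom.preimage_mono g le_top)
    (by rw [← Scheme.Hom.preimage_iSup, hcov]) fun i => ?_
  change MSections.res t ((Scheme.Modules.pullback g).obj F) _ (unitSection g F ⊤ _) = _
  rw [← unitSection_res f (t := t) F (le_top : U i ≤ ⊤), hres, unitSection_sub, ha, hb0, sub_zero]

end Core

end Summit.ResolutionOfSingularities.ResolutionOfSingularities.Cruxes.EquisingularLiftNat.P1VB

end
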